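/-
Copyright (c) 2026. All rights reserved.
Released under Apache 2.0 license as described in the file LICENSE.
Authors: abc-iut cell, wave-2 discharge seat abc-iut-L6-t6 (proof-only companion of abc-iut-L6-t4's
`GlobalFrobenioidModels.lean`).
-/
import Literature.IUT.LogThetaLattice.GlobalFrobenioidModels

/-!
# [IUTchIII] Example 3.6: the "evident" category structures and the identification `𝓕⊛_𝔪𝔬𝔡 ⥲ 𝓕⊛_MOD`, at the concrete level

Proof-only companion (DISCHARGE-L6 §E2, LIST C item C3) of
`Literature/IUT/LogThetaLattice/GlobalFrobenioidModels.lean` (seat abc-iut-L6-t4, p404192). That file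
types S. Mochizuki, *Inter-universal Teichmüller Theory III*, kurims manuscript (May 2020), Example 3.6
pp. 106–108 [claim key Mochizuki2012, status disputed, D-0012] as REAL definitions via the dictionary
"local fractional ideal `𝔍_v = λ·𝒪_{K_v}` ↔ class `[λ] ∈ Γ_v := K_v^×/𝒪^×_{K_v}`, trivialization of the pushed-out
torsor `T_v` ↔ `β_v`-equivariant map `T → Γ_v`": objects `MODObj` / elementary morphisms `ElemHom` of the
rational function torsor version `𝓕⊛_MOD` ((i), p. 107), objects `FrakObj` / `IsElemHom` / `IsHom` /
`tensorPow` / `smul` of the local fractional ideal version `𝓕⊛_𝔪𝔬𝔡` ((ii), pp. 107–108), and the object and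
elementary-morphism parts `FrakObj.toMOD`, `FrakObj.toMODHom` of the identification of (iii) (p. 108).

What the text asserts and what is PROVED here (nothing is re-defined; no new `def`):

* (ii) p. 108 l. 2–5 "There is an evident notion of composition of elementary morphisms … A morphism
  `𝔍₁ → 𝔍₂` … consist[s] of a positive integer `n` and an elementary morphism `(𝔍₁)^{⊗n} → 𝔍₂`. There is an
  evident notion of composition of morphisms. Thus, `𝓕⊛_𝔪𝔬𝔡` forms a category." — identities
  (`FrakObj.isElemHom_one`, `FrakObj.isHom_one_one`), the tensor-power bookkeeping
  (`tensorPow_one`, `tensorPow_tensorPow`, `isElemHom_tensorPow`) and COMPOSITION OF MORPHISMS with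
  multiplication of Frobenius degrees (`FrakObj.isHom_comp`: `(m, g) ∘ (n, f) = (n·m, g·f^m)`).
* (ii) p. 108 l. 9–11 "the elementary morphisms are precisely the linear morphisms, and the positive integer
  '`n`' … is the Frobenius degree" — at the concrete level: the morphisms of degree `n = 1` are exactly the
  elementary morphisms (`FrakObj.isHom_one_iff`).
* (i) p. 107 l. 14 "There is an evident notion of composition of elementary morphisms … `𝓕⊛_MOD` forms a
  category" — the category laws for abc-iut-L6-t4's `ElemHom.comp` / `ElemHom.id`
  (`ElemHom.comp_id`, `ElemHom.id_comp`, `ElemHom.comp_assoc`, via `ElemHom.ext_toEquiv`).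
* (iii) p. 108 l. 18–22 "one thus obtains a natural isomorphism of Frobenioids `𝓕⊛_𝔪𝔬𝔡 ⥲ 𝓕⊛_MOD` that induces
  the identity morphism `F^×_mod → F^×_mod` on the associated rational function monoids" — at the level of
  objects and elementary morphisms the functor `𝔍 ↦ 𝔍.toMOD`, `f ↦ (translation by f)` IS an equivalence:
  it is functorial (`toMODHom_one`, `toMODHom_mul`), FULL and FAITHFUL — every elementary morphism
  `𝔍₁.toMOD → 𝔍₂.toMOD` is translation by a UNIQUE `f ∈ F^×_mod`, and that `f` is integral w.r.t. `𝔍₁, 𝔍₂`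
  (`ElemHom.toEquiv_eq_add_of_toMOD`, `FrakObj.existsUnique_of_elemHom_toMOD`,
  `FrakObj.nonempty_elemHom_toMOD_iff`) — and ESSENTIALLY SURJECTIVE: every object `(T, {t_v})` of `𝓕⊛_MOD`
  is isomorphic, by mutually inverse elementary morphisms, to `𝔍.toMOD` for the fractional-ideal object
  `𝔍_v := [t_v(t)]⁻¹` read off the witness `t ∈ T` of condition (b) (`MODObj.exists_frakObj_iso`). The
  element `f` acts on the trivial torsor `F^×_mod` by translation by `f` itself — the concrete content of
  "induces the identity morphism on the rational function monoids".

What is NOT discharged here, and why (reported as SLOT / NEEDS per DISCHARGE-L6 §E2): the three named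
statements `Ex36i_frobenioidStructure`, `Ex36ii_frobenioidStructure`, `Ex36iii_perfectionDetermined` of
the parent file quantify over ABSTRACT Frobenioid data (`Frd`, `IsoF`, `ratFn`, `onRatFn`, `perf`) and are
predicates awaiting the REAL Frobenioid structure of [FrdI] Def. 1.3 / Cor. 4.10 (layer L1) and the
Frobenioid `𝓕⊛_mod` of [IUTchI] Ex. 5.1 (iii) (abc-iut-L5-t4); as closed statements they are neither provable
nor refutable here (a junk instance `Frd := PUnit`, `IsoF := fun _ _ => PEmpty` falsifies (i)/(ii); an
injective `onPerf` with two distinct isomorphisms falsifies (iii)). Likewise the tensor powers `𝓣^{⊗n}` of a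
GENERAL object of `𝓕⊛_MOD` (the parent file's abstract `tensorPow` argument of `Hom`) are not constructed
here; by `MODObj.exists_frakObj_iso` every object is isomorphic to one in the image of `toMOD`, where
`FrakObj.tensorPow` is the real thing. Nothing in this file bears on the disputed [IUTchIII] Cor. 3.12.
-/

namespace Literature.IUT.LogThetaLattice

namespace GlobalFrobenioidModels

universe u v w

variable {F : Type u} [Field F] {V : Type v} {Γ : V → Type w} [∀ v, AddCommGroup (Γ v)]
  {nonneg : ∀ v, AddSubmonoid (Γ v)} {β : ∀ v, Additive Fˣ →+ Γ v}

/-! ## Example 3.6 (ii): `𝓕⊛_𝔪𝔬𝔡` "forms a category" -/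

/-- Two objects of `𝓕⊛_𝔪𝔬𝔡` with the same local classes `[λ_v]` (i.e. the same fractional ideals `𝔍_v`) are
equal. [cite: Mochizuki2012, III Ex 3.6 (ii) p.107] -/
theorem FrakObj.ext_cls {J₁ J₂ : FrakObj V Γ} (h : J₁.cls = J₂.cls) : J₁ = J₂ := by
  cases J₁; cases J₂; cases h; rfl

/-- `𝔍^{⊗1} = 𝔍` ("evident notion of the `n`-th tensor power", p. 107 l. 38).
[cite: Mochizuki2012, III Ex 3.6 (ii) p.107] -/
theorem FrakObj.tensorPow_one (J : FrakObj V Γ) : J.tensorPow 1 = J :=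
  FrakObj.ext_cls (funext fun v => one_zsmul (J.cls v))

/-- `(𝔍^{⊗n})^{⊗m} = 𝔍^{⊗(m·n)}` (p. 107 l. 38). [cite: Mochizuki2012, III Ex 3.6 (ii) p.107] -/
theorem FrakObj.tensorPow_tensorPow (J : FrakObj V Γ) (n m : ℤ) :
    (J.tensorPow n).tensorPow m = J.tensorPow (m * n) :=
  FrakObj.ext_cls (funext fun v => (mul_zsmul (J.cls v) m n).symm)

/-- `(f · 𝔍)^{⊗n} = f^n · 𝔍^{⊗n}` for `n ∈ ℕ` (compatibility of the two "evident" operations of (ii),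
p. 107 l. 36–38). [cite: Mochizuki2012, III Ex 3.6 (ii) p.107] -/
theorem FrakObj.tensorPow_smul (J : FrakObj V Γ) (f : Fˣ)
    (hf : {v | β v (Additive.ofMul f) ≠ 0}.Finite) (n : ℕ)
    (hfn : {v | β v (Additive.ofMul (f ^ n)) ≠ 0}.Finite) :
    (FrakObj.smul (β := β) f hf J).tensorPow n = FrakObj.smul (β := β) (f ^ n) hfn (J.tensorPow n) := by
  refine FrakObj.ext_cls (funext fun v => ?_)
  change (n : ℤ) • (β v (Additive.ofMul f) + J.cls v) =
    β v (Additive.ofMul (f ^ n)) + (n : ℤ) • J.cls v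
  rw [ofMul_pow, map_nsmul, zsmul_add, natCast_zsmul]

/-- The identity elementary morphism `1 : 𝔍 → 𝔍` of `𝓕⊛_𝔪𝔬𝔡` (`1 · 𝔍_v ⊆ 𝔍_v`; implicit in "forms a
category", p. 108 l. 5). [cite: Mochizuki2012, III Ex 3.6 (ii) p.108] -/
theorem FrakObj.isElemHom_one (J : FrakObj V Γ) :
    FrakObj.IsElemHom (nonneg := nonneg) (β := β) J J 1 := by
  intro v
  rw [ofMul_one, map_zero, zero_add, sub_self]
  exact (nonneg v).zero_mem

/-- Morphisms of Frobenius degree `1` are exactly the elementary morphisms ("the elementary morphisms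
are precisely the linear morphisms, and the positive integer '`n`' … is the Frobenius degree", p. 108
l. 9–11, at the concrete level). [cite: Mochizuki2012, III Ex 3.6 (ii) p.108] -/
theorem FrakObj.isHom_one_iff (J₁ J₂ : FrakObj V Γ) (f : Fˣ) :
    FrakObj.IsHom (nonneg := nonneg) (β := β) J₁ J₂ 1 f ↔
      FrakObj.IsElemHom (nonneg := nonneg) (β := β) J₁ J₂ f := by
  unfold FrakObj.IsHom
  rw [show ((1 : ℕ+) : ℤ) = 1 from rfl, FrakObj.tensorPow_one]

/-- The identity morphism `(1, 1) : 𝔍 → 𝔍` of `𝓕⊛_𝔪𝔬𝔡` (p. 108 l. 5 "forms a category").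
[cite: Mochizuki2012, III Ex 3.6 (ii) p.108] -/
theorem FrakObj.isHom_one_one (J : FrakObj V Γ) :
    FrakObj.IsHom (nonneg := nonneg) (β := β) J J 1 1 :=
  (FrakObj.isHom_one_iff J J 1).mpr (FrakObj.isElemHom_one J)

/-- An elementary morphism `f : 𝔍₁ → 𝔍₂` induces `f^n : 𝔍₁^{⊗n} → 𝔍₂^{⊗n}` (`Γ_v^{≥0}` is closed under
`n·`; used for the composition of morphisms, p. 108 l. 4). [cite: Mochizuki2012, III Ex 3.6 (ii) p.108] -/
theorem FrakObj.isElemHom_tensorPow {J₁ J₂ : FrakObj V Γ} {f : Fˣ}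
    (hf : FrakObj.IsElemHom (nonneg := nonneg) (β := β) J₁ J₂ f) (n : ℕ) :
    FrakObj.IsElemHom (nonneg := nonneg) (β := β) (J₁.tensorPow n) (J₂.tensorPow n) (f ^ n) := by
  intro v
  have h := (nonneg v).nsmul_mem (hf v) n
  have e : β v (Additive.ofMul (f ^ n)) + (n : ℤ) • J₁.cls v - (n : ℤ) • J₂.cls v =
      n • (β v (Additive.ofMul f) + J₁.cls v - J₂.cls v) := by
    rw [ofMul_pow, map_nsmul, nsmul_sub, nsmul_add, natCast_zsmul, natCast_zsmul]
  change β v (Additive.ofMul (f ^ n)) + (n : ℤ) • J₁.cls v - (n : ℤ) • J₂.cls v ∈ nonneg v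
  rw [e]
  exact h

/-- **Composition of morphisms of `𝓕⊛_𝔪𝔬𝔡`** ("There is an evident notion of composition of morphisms.
Thus, `𝓕⊛_𝔪𝔬𝔡` forms a category", p. 108 l. 4–5): `(n, f) : 𝔍₁ → 𝔍₂` followed by `(m, g) : 𝔍₂ → 𝔍₃` is
`(n·m, g·f^m) : 𝔍₁ → 𝔍₃` — Frobenius degrees multiply. PROVED. [cite: Mochizuki2012, III Ex 3.6 (ii) p.108] -/
theorem FrakObj.isHom_comp {J₁ J₂ J₃ : FrakObj V Γ} {n m : ℕ+} {f g : Fˣ}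
    (hf : FrakObj.IsHom (nonneg := nonneg) (β := β) J₁ J₂ n f)
    (hg : FrakObj.IsHom (nonneg := nonneg) (β := β) J₂ J₃ m g) :
    FrakObj.IsHom (nonneg := nonneg) (β := β) J₁ J₃ (n * m) (g * f ^ (m : ℕ)) := by
  unfold FrakObj.IsHom at hf hg ⊢
  have hf' := FrakObj.isElemHom_tensorPow (nonneg := nonneg) (β := β) hf (m : ℕ)
  rw [FrakObj.tensorPow_tensorPow] at hf'
  have e : ((n * m : ℕ+) : ℤ) = ((m : ℕ) : ℤ) * ((n : ℕ+) : ℤ) := by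
    rw [PNat.mul_coe, Nat.cast_mul, mul_comm]
  rw [e]
  exact FrakObj.isElemHom_comp hf' hg

/-! ## Example 3.6 (i): `𝓕⊛_MOD` "forms a category" (laws for `ElemHom.comp`, `ElemHom.id`) -/

/-- An elementary morphism of `𝓕⊛_MOD` is determined by its underlying bijection of torsors (the
integrality condition is a property). [cite: Mochizuki2012, III Ex 3.6 (i) p.107] -/
theorem ElemHom.ext_toEquiv {T₁ T₂ : MODObj F V Γ β} {φ ψ : ElemHom (nonneg := nonneg) T₁ T₂}
    (h : φ.toEquiv = ψ.toEquiv) : φ = ψ := by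
  cases φ; cases ψ; cases h; rfl

/-- Right identity law of `𝓕⊛_MOD` ("There is an evident notion of composition of elementary morphisms",
p. 107 l. 14). [cite: Mochizuki2012, III Ex 3.6 (i) p.107] -/
theorem ElemHom.comp_id {T₁ T₂ : MODObj F V Γ β} (φ : ElemHom (nonneg := nonneg) T₁ T₂) :
    φ.comp (ElemHom.id T₁) = φ :=
  ElemHom.ext_toEquiv (Equiv.refl_trans _)

/-- Left identity law of `𝓕⊛_MOD` (p. 107 l. 14). [cite: Mochizuki2012, III Ex 3.6 (i) p.107] -/
theorem ElemHom.id_comp {T₁ T₂ : MODObj F V Γ β} (φ : ElemHom (nonneg := nonneg) T₁ T₂) :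
    (ElemHom.id T₂).comp φ = φ :=
  ElemHom.ext_toEquiv (Equiv.trans_refl _)

/-- Associativity of composition in `𝓕⊛_MOD` (p. 107 l. 14). [cite: Mochizuki2012, III Ex 3.6 (i) p.107] -/
theorem ElemHom.comp_assoc {T₁ T₂ T₃ T₄ : MODObj F V Γ β} (χ : ElemHom (nonneg := nonneg) T₃ T₄)
    (ψ : ElemHom (nonneg := nonneg) T₂ T₃) (φ : ElemHom (nonneg := nonneg) T₁ T₂) :
    (χ.comp ψ).comp φ = χ.comp (ψ.comp φ) :=
  ElemHom.ext_toEquiv (Equiv.trans_assoc _ _ _)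

/-! ## Example 3.6 (iii): the identification `𝓕⊛_𝔪𝔬𝔡 → 𝓕⊛_MOD` is functorial, fully faithful and essentially surjective -/

/-- On the trivial torsor `F^×_mod` the elementary morphism attached to `f : 𝔍₁ → 𝔍₂` is translation by
`f` — "induces the identity morphism `F^×_mod → F^×_mod` on the associated rational function monoids"
(p. 108 l. 20). [cite: Mochizuki2012, III Ex 3.6 (iii) p.108] -/
theorem FrakObj.toMODHom_toEquiv_apply {J₁ J₂ : FrakObj V Γ} (f : Fˣ)
    (hf : FrakObj.IsElemHom (nonneg := nonneg) (β := β) J₁ J₂ f) (x : Additive Fˣ) :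
    ((FrakObj.toMODHom (F := F) f hf).toEquiv x : Additive Fˣ) = Additive.ofMul f + x :=
  rfl

/-- The identification sends the identity `1 : 𝔍 → 𝔍` to the identity of `𝔍.toMOD` (functoriality of
(iii), p. 108 l. 18). [cite: Mochizuki2012, III Ex 3.6 (iii) p.108] -/
theorem FrakObj.toMODHom_one (J : FrakObj V Γ) :
    FrakObj.toMODHom (nonneg := nonneg) (β := β) (J₁ := J) (J₂ := J) 1 (FrakObj.isElemHom_one J) =
      ElemHom.id (J.toMOD (F := F) (β := β)) := by
  refine ElemHom.ext_toEquiv (Equiv.ext fun x => ?_)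
  change Additive.ofMul (1 : Fˣ) + x = x
  rw [ofMul_one, zero_add]

/-- The identification is compatible with composition: translation by `g · f` is translation by `f`
followed by translation by `g` (functoriality of (iii), p. 108 l. 18). [cite: Mochizuki2012, III Ex 3.6 (iii) p.108] -/
theorem FrakObj.toMODHom_mul {J₁ J₂ J₃ : FrakObj V Γ} {f g : Fˣ}
    (hf : FrakObj.IsElemHom (nonneg := nonneg) (β := β) J₁ J₂ f)
    (hg : FrakObj.IsElemHom (nonneg := nonneg) (β := β) J₂ J₃ g) :
    FrakObj.toMODHom (F := F) (g * f) (FrakObj.isElemHom_comp hf hg) =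
      (FrakObj.toMODHom g hg).comp (FrakObj.toMODHom f hf) := by
  refine ElemHom.ext_toEquiv (Equiv.ext fun x => ?_)
  change Additive.ofMul (g * f) + x = Additive.ofMul g + (Additive.ofMul f + x)
  rw [ofMul_mul, add_assoc]

/-- **Every elementary morphism `𝔍₁.toMOD → 𝔍₂.toMOD` of `𝓕⊛_MOD` is a translation**: its underlying
bijection of the trivial torsor `F^×_mod` is `x ↦ f + x` for `f :=` the image of the base point (an
`F^×_mod`-equivariant self-bijection of `F^×_mod` is a translation). This is the concrete content of
"induces the identity morphism `F^×_mod → F^×_mod` on the associated rational function monoids" (p. 108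
l. 20): the element of `F^×_mod` underlying the morphism acts as itself. [cite: Mochizuki2012, III Ex 3.6 (iii) p.108] -/
theorem ElemHom.toEquiv_eq_add_of_toMOD {J₁ J₂ : FrakObj V Γ}
    (φ : ElemHom (nonneg := nonneg) (J₁.toMOD (F := F) (β := β)) (J₂.toMOD (F := F) (β := β)))
    (x : Additive Fˣ) : φ.toEquiv x = φ.toEquiv 0 + x := by
  have h := φ.map_vadd x (0 : Additive Fˣ)
  change φ.toEquiv (x + 0) = x + φ.toEquiv 0 at h
  rw [add_zero] at h
  rw [h, add_comm]

/-- The element `f ∈ F^×_mod` underlying an elementary morphism `𝔍₁.toMOD → 𝔍₂.toMOD` IS integral with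
respect to `𝔍₁, 𝔍₂` — integrality of the translation at every `v` is exactly `f · 𝔍_{1,v} ⊆ 𝔍_{2,v}`
(faithfulness half of (iii), p. 108 l. 18–22). [cite: Mochizuki2012, III Ex 3.6 (iii) p.108] -/
theorem ElemHom.isElemHom_of_toMOD {J₁ J₂ : FrakObj V Γ}
    (φ : ElemHom (nonneg := nonneg) (J₁.toMOD (F := F) (β := β)) (J₂.toMOD (F := F) (β := β))) :
    FrakObj.IsElemHom (nonneg := nonneg) (β := β) J₁ J₂
      (Additive.toMul (φ.toEquiv 0 : Additive Fˣ)) := by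
  intro v
  have h := φ.integral v 0
  change β v (φ.toEquiv 0 : Additive Fˣ) - J₂.cls v - (β v (0 : Additive Fˣ) - J₁.cls v) ∈ nonneg v
    at h
  rw [(β v).map_zero, zero_sub, sub_neg_eq_add] at h
  rw [ofMul_toMul]
  convert h using 1
  abel

/-- **The identification `𝓕⊛_𝔪𝔬𝔡 → 𝓕⊛_MOD` is FULLY FAITHFUL on elementary morphisms** (p. 108 l. 18–22): every
elementary morphism `𝔍₁.toMOD → 𝔍₂.toMOD` is `toMODHom f` for a UNIQUE `f ∈ F^×_mod`, and that `f` is an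
elementary morphism `𝔍₁ → 𝔍₂` of `𝓕⊛_𝔪𝔬𝔡`. [cite: Mochizuki2012, III Ex 3.6 (iii) p.108] -/
theorem FrakObj.existsUnique_of_elemHom_toMOD {J₁ J₂ : FrakObj V Γ}
    (φ : ElemHom (nonneg := nonneg) (J₁.toMOD (F := F) (β := β)) (J₂.toMOD (F := F) (β := β))) :
    ∃! f : Fˣ, ∃ hf : FrakObj.IsElemHom (nonneg := nonneg) (β := β) J₁ J₂ f,
      FrakObj.toMODHom f hf = φ := by
  refine ⟨Additive.toMul (φ.toEquiv 0 : Additive Fˣ), ⟨ElemHom.isElemHom_of_toMOD φ, ?_⟩, ?_⟩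
  · refine ElemHom.ext_toEquiv (Equiv.ext fun x => ?_)
    rw [FrakObj.toMODHom_toEquiv_apply, ofMul_toMul, ElemHom.toEquiv_eq_add_of_toMOD φ x]
  · rintro f ⟨hf, hφ⟩
    have h0 : (φ.toEquiv 0 : Additive Fˣ) = Additive.ofMul f + (0 : Additive Fˣ) := by
      rw [← hφ]; rfl
    rw [h0, add_zero, toMul_ofMul]

/-- Elementary morphisms `𝔍₁.toMOD → 𝔍₂.toMOD` of `𝓕⊛_MOD` exist exactly when elementary morphisms `𝔍₁ → 𝔍₂`
of `𝓕⊛_𝔪𝔬𝔡` do (p. 108 l. 18–22). [cite: Mochizuki2012, III Ex 3.6 (iii) p.108] -/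
theorem FrakObj.nonempty_elemHom_toMOD_iff (J₁ J₂ : FrakObj V Γ) :
    Nonempty (ElemHom (nonneg := nonneg) (J₁.toMOD (F := F) (β := β)) (J₂.toMOD (F := F) (β := β))) ↔
      ∃ f : Fˣ, FrakObj.IsElemHom (nonneg := nonneg) (β := β) J₁ J₂ f :=
  ⟨fun ⟨φ⟩ => ⟨_, ElemHom.isElemHom_of_toMOD φ⟩, fun ⟨f, hf⟩ => ⟨FrakObj.toMODHom f hf⟩⟩

/-- **The identification `𝓕⊛_𝔪𝔬𝔡 → 𝓕⊛_MOD` is ESSENTIALLY SURJECTIVE** (object part of the "natural isomorphism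
of Frobenioids" of (iii), p. 108 l. 18, with (i) (b) p. 107 l. 6–9): for every object `𝓣 = (T, {t_v})` of
`𝓕⊛_MOD`, the witness `t ∈ T` of condition (b) defines the fractional-ideal object `𝔍_v := [t_v(t)]⁻¹`
(trivial at almost all `v`), and `g ↦ g + t` is an elementary morphism `𝔍.toMOD → 𝓣` whose inverse
`x ↦ x − t` is also an elementary morphism (both integral with defect `0` at every `v`), i.e. an
isomorphism in `𝓕⊛_MOD`. [cite: Mochizuki2012, III Ex 3.6 (iii) p.108] -/
theorem MODObj.exists_frakObj_iso (X : MODObj F V Γ β) :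
    ∃ J : FrakObj V Γ, ∃ φ : ElemHom (nonneg := nonneg) (J.toMOD (F := F) (β := β)) X,
      ∃ ψ : ElemHom (nonneg := nonneg) X (J.toMOD (F := F) (β := β)),
        (∀ x, ψ.toEquiv (φ.toEquiv x) = x) ∧ ∀ y, φ.toEquiv (ψ.toEquiv y) = y := by
  obtain ⟨x₀, hfin⟩ := X.almostAll
  have ht : ∀ v (g : Additive Fˣ), X.t v (g +ᵥ x₀) = β v g + X.t v x₀ := fun v g =>
    X.equivariant v g x₀
  refine ⟨⟨fun v => -X.t v x₀, by simpa only [ne_eq, neg_eq_zero] using hfin⟩, ?_, ?_, ?_, ?_⟩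
  · exact
      { toEquiv := Equiv.vaddConst x₀
        map_vadd := fun g x => by
          change (g + x) +ᵥ x₀ = g +ᵥ (x +ᵥ x₀)
          rw [vadd_vadd]
        integral := fun v x => by
          change X.t v (x +ᵥ x₀) - (β v x - -X.t v x₀) ∈ nonneg v
          rw [ht, sub_neg_eq_add, sub_self]
          exact (nonneg v).zero_mem }
  · exact
      { toEquiv := (Equiv.vaddConst x₀).symm
        map_vadd := fun g y => by
          change (g +ᵥ y) -ᵥ x₀ = g + (y -ᵥ x₀)
          rw [vadd_vsub_assoc]
        integral := fun v y => by
          change β v (y -ᵥ x₀) - -X.t v x₀ - X.t v y ∈ nonneg v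
          have hy : X.t v y = β v (y -ᵥ x₀) + X.t v x₀ := by
            rw [← ht v (y -ᵥ x₀), vsub_vadd]
          rw [hy, sub_neg_eq_add, sub_self]
          exact (nonneg v).zero_mem }
  · exact fun x => (Equiv.vaddConst x₀).symm_apply_apply x
  · exact fun y => (Equiv.vaddConst x₀).apply_symm_apply y

end GlobalFrobenioidModels

end Literature.IUT.LogThetaLattice
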